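import Summits.PneNP.PneNP.Theorems.NegLimitedHalfWindowMonotoneAmplificationGen
import Summits.PneNP.PneNP.Theorems.NegLimitedHalfWindowTribesBias
import Summits.PneNP.PneNP.Theorems.NegLimitedHalfWindowTribesNumerics
import Summits.PneNP.PneNP.Theorems.NegLimitedHalfWindowTribesCount
import Summits.PneNP.PneNP.Theorems.NegLimitedHalfWindowEngineAssembly
import Summits.PneNP.PneNP.Theorems.NegLimitedHalfWindowSlicesNP
import Summits.PneNP.PneNP.Theorems.NegLimitedHalfWindowDoorAssembly
import Mathlib
import HarnessLib

/-!
# Route NegLimited — rung R2 `NegLimited.NeglimitedHalfLogNegationsR` via the line `half-window`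
(rung F-N1/p3, ROUND-13; item stmt-PneNP-19888, rank 3; registered skeleton HOME/pnp-ideate-p3/r13/half-window.lean,
v1 sha16 0a142adbfebe452b = the tree's `NegLimitedHalfWindowDefs.lean`)

The composition, VERBATIM from pnp-ideate-p3's skeleton (`NeglimitedHalfLogNegationsR_of`, landed in
`NegLimitedHalfWindowDefs.lean`): the seven registered stubs, all now theorems BY NAME in the tree, conclude
the rung by modus ponens —
* A-gen `stub_monotoneAmplificationGen` (`…MonotoneAmplificationGen.lean`, prover-2 p489997),
* TB `stub_tribesBiasResponse` (`…TribesBias.lean`, prover-1 p490765),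
* N `stub_tribesNumericsCal` (`…TribesNumerics.lean`, prover-1 p493014),
* C `stub_tribesRM3Count` (`…TribesCount.lean`, prover-1 p490844),
* EA′ `stub_halfEngineAssembly` (`…EngineAssembly.lean`, prover-2 p491190),
* S′ `stub_halfSlicesNP` (`…SlicesNP.lean`, prover-2),
* DA′ `stub_halfDoorAssembly` (`…DoorAssembly.lean`, prover-2 p492323);
the base B (`stub_criticalWindow`, p472908) and the gap transfer T′ (`gapTransfer_holds`) are fed inside
`NeglimitedHalfLogNegationsR_of`.

STATEMENT PROVED (the route decl BY NAME): for every `ε > 0` there is ONE language `L ∈ NP` with monotone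
slices such that for every exponent `k`, for infinitely many `n`, every De Morgan circuit computing the slice
`L ∩ {0,1}ⁿ` with at most `⌊(1/2 − ε)·log₂ n⌋` NOT gates has more than `n^k` gates.

HONEST FRAMING: FRONTIER rung F-N1 — a negation-limited lower bound (Rossman-adjacent: Rossman, CCC 2015,
Cor. 1.4 has the constant `1/2 − ε` for NC¹; Amano–Maruoka 2005 have `(1/6)·log log n` for unbounded depth);
the method's ceiling is `(1/2)·log₂ n + O(log log n)` negations (O'Donnell–Wimmer), so this is the LAST rung of
this ladder (p3 ROUND-13 §3).  Novelty-vs-print is the business of the cell's print sweep, not of this file.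
NOTHING here bears on P vs NP: the route NegLimited's thesis (`⌈log₂(n+1)⌉` negations suffice for P ≠ NP,
Markov/Fischer) is far beyond `(1/2 − ε)·log₂ n`.
-/

set_option linter.dupNamespace false -- `Summit.PneNP.PneNP.…`: summit = sub-problem name (D-0017 single-conjunct layout)

namespace Summit.PneNP.PneNP.Theorems.NegLimitedHalfWindow

/-- **Rung R2 of route NegLimited** (stmt-PneNP-19888), BY NAME: pnp-ideate-p3's composition
`NeglimitedHalfLogNegationsR_of` fed with the seven landed stubs of the line `half-window`. -/
theorem neglimitedHalfLogNegationsR_via_halfWindow :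
    Summit.PneNP.PneNP.Theses.NegLimited.NeglimitedHalfLogNegationsR :=
  NeglimitedHalfLogNegationsR_of stub_monotoneAmplificationGen stub_tribesBiasResponse stub_tribesNumericsCal
    stub_tribesRM3Count stub_halfEngineAssembly stub_halfSlicesNP stub_halfDoorAssembly

end Summit.PneNP.PneNP.Theorems.NegLimitedHalfWindow
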